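import Summits.ResolutionOfSingularities.ResolutionOfSingularities.Theorems.EquisingularLiftEquisingularLiftNatVertexLineDefs
import Summits.ResolutionOfSingularities.ResolutionOfSingularities.Theorems.EquisingularLiftEquisingularLiftNatVanishingIdealOfChart
import Literature.AlgebraicGeometry.Resolution.VertexBlowupProjectionMorphism
import Literature.RingTheory.MvPolynomial.VariableIdeals
import HarnessLib

/-!
# [OURS · L1 W4.5(b) · EL♮(3) · nose residue, D3-9 file 4/5] The strict transform of the vertex line on the chart OFF the vertex,
# `b⁻¹D₊(x_{i₀}) ≅ D₊(x_{i₀}) = Spec (k[x]_{(x_{i₀})})₀`: the lifted chart, its ideal `(x_j/x_{i₀} : j ≤ d, j ≠ i₀)`, generators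

Crux chain w45b, child EL♮(3) = stmt-ResolutionOfSingularities-20148; desk table D3, row **D3-9** (res-L1-w45b-nose-w3 g2).
`--supports stmt-ResolutionOfSingularities-20148 --as helper`. OURS; NOT a statement of any manuscript; AI-written, weaker than expert review.
No `sorry`; standard axioms; DEF-FREE (the de Jong kit's `attribute [local instance] MvPolynomial.gradedAlgebra` is needed to write `Proj k[x]`).

Setting: ANY blowing up `b : P̃ ⟶ ℙ^{d+1}_k` of the vertex `p`; `i₀' = castSucc i₀`; `U = D₊(x_{i₀'}) ∌ p`, over which `b` is an isomorphism
(`IsBlowup.isIso_morphismRestrict`); the standard chart `chartι k i₀' = awayι : Spec (k[x]_{(x_{i₀'})})₀ ⟶ ℙ^{d+1}`. PROVED: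

* `exists_lift_of_isBlowup_vertex` — **the chart `D₊(x_{i₀'})` LIFTS through `b`**: an open immersion `cB : Spec (k[x]_{(x_{i₀'})})₀ ⟶ P̃` with
  `cB ≫ b = chartι k i₀'` and image `b⁻¹D₊(x_{i₀'})` (pattern of res-L1-w45b-iso-w1's `ND.untouchedChart`).
* ALGEBRA in `(k[x]_{(x_{i₀'})})₀ ≅ k[Y_a : a ≠ i₀']` (`PointBlowup.awayBaseEquiv`): the ideal `𝔮_B = (x_a/x_{i₀'} : a = castSucc (succAbove i₀ m))` is
  prime (`isPrime_span_fracB`, ideal of a set of variables).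
* POINTS: `preimage_lift_vertexLineStrict` — **`cB⁻¹(vertexLineStrict b i₀) = V(𝔮_B)`** (over `D₊(x_{i₀'})` the strict transform IS `b⁻¹(vertexLine)`;
  `Motives.ProjSubscheme.awayι_preimage_zeroLocus`).
* SECTIONS: the generators `lsRatio z i₀ (succAbove m)` restricted to `cB(Spec)` go to `x_a/x_{i₀'}` under `θ_B = ΓSpecIso ∘ cB.appIso ⊤`
  (`chartRingEquiv_lsRatio_B`: ✓ `map_lsRatio_eq_app_ratio` + ✓ `appLE_chartι_ratio`), hence ★ `span_lsRatio_eq_vanishingIdeal_B` (they GENERATE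
  `𝓘⟨vertexLineStrict⟩` over the chart) and ★ `isQuasiRegular_lsRatio_B`.

References (index only): The Stacks Project, Tags 0804, 02OS [cite: StacksProject]; R. Hartshorne (1977), II Prop. 2.5, II §7 [cite: Hartshorne1977];
A. J. de Jong (1996), proof of Lemma 4.11 [cite: DeJong1996].
-/

set_option linter.dupNamespace false -- mandated namespace `Summit.<Summit>.<Problem>` of this single-conjunct summit

noncomputable section

open CategoryTheory AlgebraicGeometry TopologicalSpace HomogeneousLocalization Topology Opposite
open Literature.AlgebraicGeometry.Resolution Literature.AlgebraicGeometry.Resolution.DeJong1996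
open Literature.AlgebraicGeometry.Motives.Segre (grading X_mem chartι)
open Literature.RingTheory.MvPolynomial (isPrime_span_X_image)

attribute [local instance] MvPolynomial.gradedAlgebra

namespace Summit.ResolutionOfSingularities.ResolutionOfSingularities.Cruxes.EquisingularLiftNat.Sections

/-! ## Lifting an open immersion through a blowing up that is an isomorphism over its image -/

/-- **An open immersion into the base whose image misses the centre lifts through the blowing up** (Stacks 02OS: the blowing up is an
isomorphism over the complement of the centre): an open immersion `c' : Y ⟶ X'` with `c' ≫ π = c` and image `π⁻¹(c(Y))`.
[cite: StacksProject, Tag 02OS] (OURS spelling of res-L1-w45b-iso-w1's `ND.untouchedChart` construction; folklore) -/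
theorem exists_lift_openImmersion_of_isBlowup {Y X X' : Scheme.{0}} (π : X' ⟶ X) {I : X.IdealSheafData} (hπ : IsBlowup π I)
    (c : Y ⟶ X) [IsOpenImmersion c] (hdisj : Disjoint (Set.range c) (I.support : Set X)) :
    ∃ (c' : Y ⟶ X') (_ : IsOpenImmersion c'), c' ≫ π = c ∧ c' ''ᵁ ⊤ = π ⁻¹ᵁ c.opensRange := by
  set U : X.Opens := c.opensRange with hUdef
  have hdisj' : Disjoint (U : Set X) (I.support : Set X) := hdisj
  haveI hiso : IsIso (π ∣_ U) := hπ.isIso_morphismRestrict hdisj'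
  let c' : Y ⟶ X' := c.isoOpensRange.hom ≫ inv (π ∣_ U) ≫ (π ⁻¹ᵁ U).ι
  have hc'π : c' ≫ π = c := by
    simp only [c', Category.assoc]
    rw [← morphismRestrict_ι, IsIso.inv_hom_id_assoc, Scheme.Hom.isoOpensRange_hom_ι]
  haveI hc'open : IsOpenImmersion c' := by
    simp only [c']
    infer_instance
  refine ⟨c', hc'open, hc'π, ?_⟩
  have hsurj : Function.Surjective ⇑(c.isoOpensRange.hom ≫ inv (π ∣_ U)) :=
    (Scheme.Hom.homeomorph (c.isoOpensRange.hom ≫ inv (π ∣_ U))).surjective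
  apply Opens.ext
  rw [Scheme.Hom.image_top_eq_opensRange, Scheme.Hom.coe_opensRange]
  apply le_antisymm
  · rintro _ ⟨a, rfl⟩
    exact ((c.isoOpensRange.hom ≫ inv (π ∣_ U)) a).2
  · intro z hz
    obtain ⟨a, ha⟩ := hsurj ⟨z, hz⟩
    refine ⟨a, ?_⟩
    change (π ⁻¹ᵁ U).ι ((c.isoOpensRange.hom ≫ inv (π ∣_ U)) a) = z
    rw [ha]
    rfl

/-! ## Algebra in `(k[x]_{(x_{i₀'})})₀ ≅ k[Y_a : a ≠ i₀']` -/

section Algebra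

variable {d : ℕ} {k : Type} [Field k] (i₀ : Fin (d + 1))

/-- The index `castSucc (succAbove i₀ m)` is not `castSucc i₀`. [folklore] -/
theorem castSucc_succAbove_ne (m : Fin d) : Fin.castSucc (i₀.succAbove m) ≠ Fin.castSucc i₀ :=
  fun h => Fin.succAbove_ne i₀ m (Fin.castSucc_injective _ h)

/-- **The ideal `(x_a/x_{i₀'} : a = castSucc (succAbove i₀ m), m < d)` of `(k[x]_{(x_{i₀'})})₀` is prime** (under `awayBaseEquiv` it is the ideal of
a set of variables of `k[Y_a : a ≠ i₀']`). [folklore] -/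
theorem isPrime_span_fracB :
    (Ideal.span (Set.range fun m : Fin d =>
      Literature.AlgebraicGeometry.Motives.Segre.frac k (Fin.castSucc i₀) (Fin.castSucc (i₀.succAbove m)))).IsPrime := by
  let e := PointBlowup.awayBaseEquiv (d + 1) k (Fin.castSucc i₀)
  let v : Fin d → {j : Fin (d + 1 + 1) // j ≠ Fin.castSucc i₀} := fun m => ⟨Fin.castSucc (i₀.succAbove m), castSucc_succAbove_ne i₀ m⟩
  have hfun : (e.toRingHom ∘ fun m : Fin d =>
      Literature.AlgebraicGeometry.Motives.Segre.frac k (Fin.castSucc i₀) (Fin.castSucc (i₀.succAbove m))) = MvPolynomial.X ∘ v := by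
    funext m
    exact PointBlowup.awayBaseEquiv_frac (d + 1) k (Fin.castSucc i₀) (castSucc_succAbove_ne i₀ m)
  have hmap : (Ideal.span (Set.range fun m : Fin d =>
      Literature.AlgebraicGeometry.Motives.Segre.frac k (Fin.castSucc i₀) (Fin.castSucc (i₀.succAbove m)))).map e.toRingHom =
      Ideal.span (MvPolynomial.X '' Set.range v) := by
    rw [Ideal.map_span, ← Set.range_comp, hfun, Set.range_comp]
  have hprime : ((Ideal.span (Set.range fun m : Fin d =>
      Literature.AlgebraicGeometry.Motives.Segre.frac k (Fin.castSucc i₀) (Fin.castSucc (i₀.succAbove m)))).map e.toRingHom).IsPrime := by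
    rw [hmap]
    exact isPrime_span_X_image (R := k) (Set.range v)
  rw [← Ideal.comap_map_of_bijective e.toRingHom (e.bijective : Function.Bijective e.toRingHom)
    (I := Ideal.span (Set.range fun m : Fin d =>
      Literature.AlgebraicGeometry.Motives.Segre.frac k (Fin.castSucc i₀) (Fin.castSucc (i₀.succAbove m))))]
  exact Ideal.comap_isPrime e.toRingHom _

end Algebra

/-! ## The chart off the vertex -/

section ChartB

variable {d : ℕ} {k : Type} [Field k] {P : Scheme.{0}} (b : P ⟶ Proj (grading (Fin (d + 1 + 1)) k))
  (hb : IsBlowup b (vertexIdealSheaf d k)) (i₀ : Fin (d + 1))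

/-- `D₊(x_{i₀'})` misses the centre `{vertex}` of the blowing up. [folklore] -/
theorem disjoint_range_chartι_support :
    Disjoint (Set.range (chartι k (Fin.castSucc i₀))) ((vertexIdealSheaf d k).support : Set (Proj (grading (Fin (d + 1 + 1)) k))) := by
  rw [Set.disjoint_left]
  rintro _ ⟨y, rfl⟩ hy
  have hy' : chartι k (Fin.castSucc i₀) y ∈ ({vertex d k} : Set _) := by
    rw [Scheme.IdealSheafData.coe_support_vanishingIdeal] at hy
    exact hy
  rw [Set.mem_singleton_iff] at hy'
  apply vertex_notMem_basicOpen d k i₀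
  rw [← hy', ← Proj.opensRange_awayι _ _ (X_mem k (Fin.castSucc i₀)) zero_lt_one]
  exact ⟨y, rfl⟩

include hb in
/-- ★ **The chart `D₊(x_{i₀'})` lifts through the blowing up of the vertex**: an open immersion `cB : Spec (k[x]_{(x_{i₀'})})₀ ⟶ P̃` with
`cB ≫ b = chartι k i₀'` and `cB(Spec) = b⁻¹D₊(x_{i₀'})`. [cite: StacksProject, Tag 02OS] (OURS instance) -/
theorem exists_lift_of_isBlowup_vertex :
    ∃ (cB : Spec (.of (Away (grading (Fin (d + 1 + 1)) k) (MvPolynomial.X (Fin.castSucc i₀)))) ⟶ P) (_ : IsOpenImmersion cB),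
      cB ≫ b = chartι k (Fin.castSucc i₀) ∧
        cB ''ᵁ ⊤ = b ⁻¹ᵁ Proj.basicOpen (grading (Fin (d + 1 + 1)) k) (MvPolynomial.X (Fin.castSucc i₀)) := by
  obtain ⟨cB, hopen, hcomp, himage⟩ :=
    exists_lift_openImmersion_of_isBlowup b hb (chartι k (Fin.castSucc i₀)) (disjoint_range_chartι_support i₀)
  refine ⟨cB, hopen, hcomp, ?_⟩
  rw [himage, Proj.opensRange_awayι]

variable {b} (cB : Spec (.of (Away (grading (Fin (d + 1 + 1)) k) (MvPolynomial.X (Fin.castSucc i₀)))) ⟶ P)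
  (hcB : cB ≫ b = chartι k (Fin.castSucc i₀))

include hcB in
/-- Where the lifted chart sends a point: `b (cB 𝔭) = awayι 𝔭`. [folklore] -/
theorem lift_comp_apply (𝔭 : Spec (.of (Away (grading (Fin (d + 1 + 1)) k) (MvPolynomial.X (Fin.castSucc i₀))))) :
    b (cB 𝔭) = chartι k (Fin.castSucc i₀) 𝔭 := by
  rw [← Scheme.Hom.comp_apply, hcB]

include hcB in
/-- The lifted chart maps into `b⁻¹D₊(x_{i₀'})`. [folklore] -/
theorem lift_apply_mem_preimage (𝔭 : Spec (.of (Away (grading (Fin (d + 1 + 1)) k) (MvPolynomial.X (Fin.castSucc i₀))))) :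
    b (cB 𝔭) ∈ Proj.basicOpen (grading (Fin (d + 1 + 1)) k) (MvPolynomial.X (Fin.castSucc i₀)) := by
  rw [lift_comp_apply i₀ cB hcB, ← Proj.opensRange_awayι _ _ (X_mem k (Fin.castSucc i₀)) zero_lt_one]
  exact ⟨𝔭, rfl⟩

include hcB in
/-- **Over `D₊(x_{i₀'})` the strict transform is the total transform**: `cB 𝔭 ∈ vertexLineStrict ↔ awayι 𝔭 ∈ vertexLine`. [folklore] -/
theorem lift_apply_mem_vertexLineStrict_iff (𝔭 : Spec (.of (Away (grading (Fin (d + 1 + 1)) k) (MvPolynomial.X (Fin.castSucc i₀))))) :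
    cB 𝔭 ∈ vertexLineStrict b i₀ ↔ chartι k (Fin.castSucc i₀) 𝔭 ∈ vertexLine d k i₀ := by
  constructor
  · intro h
    rw [← lift_comp_apply i₀ cB hcB]
    exact vertexLineStrict_subset_preimage b i₀ h
  · intro h
    apply preimage_diff_subset_vertexLineStrict b i₀
    refine ⟨?_, ?_⟩
    · show b (cB 𝔭) ∈ vertexLine d k i₀
      rwa [lift_comp_apply i₀ cB hcB]
    · show b (cB 𝔭) ∉ ({vertex d k} : Set _)
      rw [Set.mem_singleton_iff]
      intro h'
      exact vertex_notMem_basicOpen d k i₀ (h' ▸ lift_apply_mem_preimage i₀ cB hcB 𝔭)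

/-- A point of `D₊(x_{i₀'}) = Spec (k[x]_{(x_{i₀'})})₀` lies on the line iff the `x_a/x_{i₀'}`, `a = castSucc j`, `j ≠ i₀`, vanish at it.
[folklore] -/
theorem chartι_apply_mem_vertexLine_iff (𝔭 : Spec (.of (Away (grading (Fin (d + 1 + 1)) k) (MvPolynomial.X (Fin.castSucc i₀))))) :
    chartι k (Fin.castSucc i₀) 𝔭 ∈ vertexLine d k i₀ ↔
      ∀ j : Fin (d + 1), j ≠ i₀ → Literature.AlgebraicGeometry.Motives.Segre.frac k (Fin.castSucc i₀) (Fin.castSucc j) ∈ 𝔭.asIdeal := by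
  rw [mem_vertexLine_iff]
  refine forall_congr' fun j => imp_congr_right fun _ => ?_
  have h := Set.ext_iff.mp (Literature.AlgebraicGeometry.Motives.ProjSubscheme.awayι_preimage_zeroLocus (grading (Fin (d + 1 + 1)) k)
    (X_mem k (Fin.castSucc i₀)) zero_lt_one (X_mem k (Fin.castSucc j)) zero_lt_one) 𝔭
  change ({(MvPolynomial.X (Fin.castSucc j) : MvPolynomial (Fin (d + 1 + 1)) k)} : Set _) ⊆
      ((chartι k (Fin.castSucc i₀) 𝔭).asHomogeneousIdeal : Set _) ↔
    ({Literature.AlgebraicGeometry.Motives.Segre.frac k (Fin.castSucc i₀) (Fin.castSucc j)} : Set _) ⊆ (𝔭.asIdeal : Set _) at h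
  rwa [Set.singleton_subset_iff, Set.singleton_subset_iff] at h

include hcB in
/-- ★ **The strict transform of the line meets the lifted chart in `V(x_a/x_{i₀'} : a = castSucc (succAbove i₀ m))`.**
[cite: Hartshorne1977, II §7] (OURS computation; folklore) -/
theorem preimage_lift_vertexLineStrict :
    cB ⁻¹' vertexLineStrict b i₀ = PrimeSpectrum.zeroLocus (Ideal.span (Set.range fun m : Fin d =>
      Literature.AlgebraicGeometry.Motives.Segre.frac k (Fin.castSucc i₀) (Fin.castSucc (i₀.succAbove m))) : Set _) := by
  ext 𝔭
  rw [Set.mem_preimage, lift_apply_mem_vertexLineStrict_iff i₀ cB hcB, chartι_apply_mem_vertexLine_iff]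
  change _ ↔ Ideal.span _ ≤ 𝔭.asIdeal
  rw [Ideal.span_le, Set.range_subset_iff]
  constructor
  · intro h m
    exact h (i₀.succAbove m) (Fin.succAbove_ne i₀ m)
  · intro h j hj
    obtain ⟨m, rfl⟩ := Fin.exists_succAbove_eq hj
    exact h m

/-! ### Sections on the lifted chart -/

variable [IsOpenImmersion cB]

include hcB in
/-- `cB(Spec) ⊆ b⁻¹D₊(x_{i₀'})`. [folklore] -/
theorem image_top_le_preimage_basicOpen :
    cB ''ᵁ ⊤ ≤ b ⁻¹ᵁ Proj.basicOpen (grading (Fin (d + 1 + 1)) k) (MvPolynomial.X (Fin.castSucc i₀)) := by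
  rintro _ ⟨𝔭, -, rfl⟩
  exact lift_apply_mem_preimage i₀ cB hcB 𝔭

variable [IsIntegral P] [IsDominant b]

include hcB in
/-- `cB(Spec) ⊆ lsChart z i₀`. [folklore] -/
theorem image_top_le_lsChart_B : cB ''ᵁ ⊤ ≤ lsChart (blowupRatFn b) i₀ :=
  (image_top_le_preimage_basicOpen i₀ cB hcB).trans (preimage_basicOpen_le_lsChart b i₀)

include hcB in
/-- **The generators pulled back to the lifted chart**: `θ_B (lsRatio z i₀ a|) = x_a/x_{i₀'}` (`a ≤ d`). [folklore] -/
theorem chartRingEquiv_lsRatio_B (a : Fin (d + 1)) :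
    (Scheme.ΓSpecIso (.of (Away (grading (Fin (d + 1 + 1)) k) (MvPolynomial.X (Fin.castSucc i₀))))).hom ((cB.appIso ⊤).hom
      (P.presheaf.map (homOfLE (image_top_le_lsChart_B i₀ cB hcB)).op (lsRatio (blowupRatFn b) i₀ a))) =
      Literature.AlgebraicGeometry.Motives.Segre.frac k (Fin.castSucc i₀) (Fin.castSucc a) := by
  have hle : (⊤ : (Spec (.of (Away (grading (Fin (d + 1 + 1)) k) (MvPolynomial.X (Fin.castSucc i₀))))).Opens) ≤
      cB ⁻¹ᵁ b ⁻¹ᵁ (gensP d k).U (Fin.castSucc i₀) := fun 𝔭 _ => lift_apply_mem_preimage i₀ cB hcB 𝔭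
  have hL : (⊤ : (Spec (.of (Away (grading (Fin (d + 1 + 1)) k) (MvPolynomial.X (Fin.castSucc i₀))))).Opens) ≤
      cB ⁻¹ᵁ lsChart (blowupRatFn b) i₀ := fun 𝔭 _ => image_top_le_lsChart_B i₀ cB hcB ⟨𝔭, trivial, rfl⟩
  have h1a : (cB.appIso ⊤).hom (P.presheaf.map (homOfLE (image_top_le_lsChart_B i₀ cB hcB)).op (lsRatio (blowupRatFn b) i₀ a)) =
      cB.appLE (lsChart (blowupRatFn b) i₀) ⊤ hL (lsRatio (blowupRatFn b) i₀ a) := by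
    rw [Scheme.Hom.appIso_hom', ← CommRingCat.comp_apply, Scheme.Hom.map_appLE]
  have h1b : cB.appLE (b ⁻¹ᵁ (gensP d k).U (Fin.castSucc i₀)) ⊤ hle
        (P.presheaf.map (homOfLE (preimage_basicOpen_le_lsChart b i₀)).op (lsRatio (blowupRatFn b) i₀ a)) =
      cB.appLE (lsChart (blowupRatFn b) i₀) ⊤ hL (lsRatio (blowupRatFn b) i₀ a) := by
    have e := Scheme.Hom.map_appLE cB (U := b ⁻¹ᵁ (gensP d k).U (Fin.castSucc i₀)) (V := ⊤) hle
      (homOfLE (preimage_basicOpen_le_lsChart b i₀)).op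
    exact DFunLike.congr_fun (congrArg CommRingCat.Hom.hom e) (lsRatio (blowupRatFn b) i₀ a)
  have h1 : (cB.appIso ⊤).hom (P.presheaf.map (homOfLE (image_top_le_lsChart_B i₀ cB hcB)).op (lsRatio (blowupRatFn b) i₀ a)) =
      cB.appLE (b ⁻¹ᵁ (gensP d k).U (Fin.castSucc i₀)) ⊤ hle
        (P.presheaf.map (homOfLE (preimage_basicOpen_le_lsChart b i₀)).op (lsRatio (blowupRatFn b) i₀ a)) := h1a.trans h1b.symm
  have h2 : cB.appLE (b ⁻¹ᵁ (gensP d k).U (Fin.castSucc i₀)) ⊤ hle (b.app ((gensP d k).U (Fin.castSucc i₀))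
        ((gensP d k).ratio (Fin.castSucc i₀) (Fin.castSucc a))) =
      (cB ≫ b).appLE ((gensP d k).U (Fin.castSucc i₀)) ⊤ hle ((gensP d k).ratio (Fin.castSucc i₀) (Fin.castSucc a)) := by
    rw [Scheme.Hom.app_eq_appLE, ← CommRingCat.comp_apply, Scheme.Hom.appLE_comp_appLE]
  rw [h1, map_lsRatio_eq_app_ratio b i₀ a, h2, appLE_congr_hom hcB, appLE_chartι_ratio, ← CommRingCat.comp_apply, Iso.inv_hom_id,
    CommRingCat.id_apply]

include hcB in
/-- ★ **The `lsRatio z i₀ (succAbove m)|`, `m < d`, generate `𝓘⟨vertexLineStrict b i₀⟩` over the lifted chart.**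
[cite: Hartshorne1977, II Example 3.2.6] (OURS computation; folklore) -/
theorem span_lsRatio_eq_vanishingIdeal_B :
    Ideal.span (Set.range fun m : Fin d =>
        P.presheaf.map (homOfLE (image_top_le_lsChart_B i₀ cB hcB)).op (lsRatio (blowupRatFn b) i₀ (i₀.succAbove m))) =
      (Scheme.IdealSheafData.vanishingIdeal ⟨vertexLineStrict b i₀, isClosed_vertexLineStrict b i₀⟩).ideal
        ⟨cB ''ᵁ ⊤, isAffineOpen_image_top cB⟩ :=
  span_range_eq_vanishingIdeal_ideal cB ⟨vertexLineStrict b i₀, isClosed_vertexLineStrict b i₀⟩ _ (isPrime_span_fracB i₀).isRadical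
    (preimage_lift_vertexLineStrict i₀ cB hcB) _ rfl _ (fun m => chartRingEquiv_lsRatio_B i₀ cB hcB (i₀.succAbove m))

omit [IsIntegral P] [IsDominant b] [IsOpenImmersion cB] in
/-- The `x_a/x_{i₀'}`, `a = castSucc (succAbove i₀ m)`, form a quasi-regular sequence of `(k[x]_{(x_{i₀'})})₀` (distinct variables of
`k[Y_a : a ≠ i₀']`). [cite: Matsumura1987, Thm. 16.2 (i)] (folklore instance) -/
theorem isQuasiRegular_fracB :
    IsQuasiRegular (fun m : Fin d => Literature.AlgebraicGeometry.Motives.Segre.frac k (Fin.castSucc i₀) (Fin.castSucc (i₀.succAbove m))) := by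
  let e := (PointBlowup.awayBaseEquiv (d + 1) k (Fin.castSucc i₀)).symm
  let v : Fin d → {j : Fin (d + 1 + 1) // j ≠ Fin.castSucc i₀} := fun m => ⟨Fin.castSucc (i₀.succAbove m), castSucc_succAbove_ne i₀ m⟩
  have hv : Function.Injective v := fun m m' h => by
    have h' := congrArg Subtype.val h
    exact Fin.succAbove_right_injective (Fin.castSucc_injective _ h')
  have he : (fun m : Fin d => Literature.AlgebraicGeometry.Motives.Segre.frac k (Fin.castSucc i₀) (Fin.castSucc (i₀.succAbove m))) =
      e ∘ fun m => MvPolynomial.X (v m) := by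
    funext m
    change _ = (PointBlowup.awayBaseEquiv (d + 1) k (Fin.castSucc i₀)).symm (MvPolynomial.X (v m))
    rw [← PointBlowup.awayBaseEquiv_frac (d + 1) k (Fin.castSucc i₀) (castSucc_succAbove_ne i₀ m), RingEquiv.symm_apply_apply]
  rw [he]
  refine IsQuasiRegular.map_ringEquiv (isQuasiRegular_of_isWeaklyRegular _ ?_) e
  have h := MvPolynomial.isWeaklyRegular_map_X (R := k) (List.ofFn v) (List.nodup_ofFn.mpr hv)
  rwa [List.map_ofFn] at h

include hcB in
/-- ★ **The restricted generators form a quasi-regular sequence of `Γ(P̃, cB(Spec))`.** [cite: Matsumura1987, Thm. 16.2 (i)] (OURS instance) -/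
theorem isQuasiRegular_lsRatio_B :
    IsQuasiRegular (fun m : Fin d =>
      P.presheaf.map (homOfLE (image_top_le_lsChart_B i₀ cB hcB)).op (lsRatio (blowupRatFn b) i₀ (i₀.succAbove m))) := by
  let θ : Γ(P, cB ''ᵁ ⊤) ≃+* Away (grading (Fin (d + 1 + 1)) k) (MvPolynomial.X (Fin.castSucc i₀)) :=
    (cB.appIso ⊤ ≪≫ Scheme.ΓSpecIso (.of (Away (grading (Fin (d + 1 + 1)) k) (MvPolynomial.X (Fin.castSucc i₀))))).commRingCatIsoToRingEquiv
  have h : (fun m : Fin d => P.presheaf.map (homOfLE (image_top_le_lsChart_B i₀ cB hcB)).op (lsRatio (blowupRatFn b) i₀ (i₀.succAbove m))) =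
      θ.symm ∘ fun m => Literature.AlgebraicGeometry.Motives.Segre.frac k (Fin.castSucc i₀) (Fin.castSucc (i₀.succAbove m)) := by
    funext m
    apply θ.injective
    change _ = θ (θ.symm _)
    rw [RingEquiv.apply_symm_apply]
    exact chartRingEquiv_lsRatio_B i₀ cB hcB (i₀.succAbove m)
  rw [h]
  exact (isQuasiRegular_fracB i₀).map_ringEquiv θ.symm

end ChartB

end Summit.ResolutionOfSingularities.ResolutionOfSingularities.Cruxes.EquisingularLiftNat.Sections

end
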